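import Summits.MatrixMultiplication.MatrixMultiplication.Theses.HiddenToeplitzCorners

/-!
# `HiddenToeplitzCorners.CornerCriterion` — the corner criterion

Item `stmt-MatrixMultiplication-7494` (support, route `HiddenToeplitzCorners`).

If a linear pencil `T(X) = ∑_{a,b} X_{ab} • T_{ab}` of `N × N` complex matrices hides a linearly
explained `r × r` corner — `T(X) E = F X` for all `X`, with a frame `E ∈ ℂ^{N × r}` of rank `r` —
then `T(X)` is singular whenever `X` is: a kernel vector `v ≠ 0` of `X` gives the kernel vector
`E v` of `T(X)` (`T(X) (E v) = F (X v) = 0`), and `E v ≠ 0` because a rank-`r` matrix with `r`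
columns has injective `mulVec` (rank–nullity).  Three lines on the card; the Lean proof is
`Matrix.exists_mulVec_eq_zero_iff` (both directions) plus `LinearMap.finrank_range_add_finrank_ker`.
-/

-- `Summit.<Summit>.<Problem>` is the tree's mandated summit-side namespace; for this
-- single-conjunct summit the two coincide, so the file silences `dupNamespace`.
set_option linter.dupNamespace false

namespace Summit.MatrixMultiplication.MatrixMultiplication.Theorems

/-- A complex `N × r` matrix of rank `r` has injective `mulVec` (full column rank ⇒ trivial kernel,
by rank–nullity on `E.mulVecLin : (Fin r → ℂ) →ₗ[ℂ] (Fin N → ℂ)`). -/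
theorem mulVec_injective_of_rank_eq {r N : ℕ} (E : Matrix (Fin N) (Fin r) ℂ) (hE : E.rank = r) :
    Function.Injective E.mulVec := by
  have hker : LinearMap.ker E.mulVecLin = ⊥ := by
    have h := LinearMap.finrank_range_add_finrank_ker E.mulVecLin
    rw [Module.finrank_fin_fun] at h
    have hr : Module.finrank ℂ (LinearMap.range E.mulVecLin) = r := hE
    rw [hr] at h
    exact Submodule.finrank_eq_zero.mp (by omega)
  have hinj : Function.Injective E.mulVecLin := LinearMap.ker_eq_bot.mp hker
  intro v w hvw
  exact hinj (by simpa [Matrix.mulVecLin_apply] using hvw)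

open Summit.MatrixMultiplication.MatrixMultiplication.Theses.HiddenToeplitzCorners in
/-- **Corner criterion** (item `stmt-MatrixMultiplication-7494`): if `E ∈ ℂ^{N × r}` has rank `r`
and `T(X) E = F X` for every `X`, then `det X = 0 → det T(X) = 0`, where
`T(X) = ∑ a b, X a b • T a b`.  Proof: pick `v ≠ 0` with `X v = 0`; then `E v ≠ 0` (injectivity of
`E.mulVec`) and `T(X) (E v) = (T(X) E) v = (F X) v = F (X v) = 0`. -/
theorem cornerCriterion_proof :
    Summit.MatrixMultiplication.MatrixMultiplication.Theses.HiddenToeplitzCorners.CornerCriterion := by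
  unfold CornerCriterion
  intro r N T E F hE hTE X hX
  obtain ⟨v, hv0, hXv⟩ := Matrix.exists_mulVec_eq_zero_iff.mpr hX
  have hinj := mulVec_injective_of_rank_eq E hE
  refine Matrix.exists_mulVec_eq_zero_iff.mp ⟨E.mulVec v, ?_, ?_⟩
  · intro h
    apply hv0
    apply hinj
    rw [h, Matrix.mulVec_zero]
  · rw [Matrix.mulVec_mulVec, hTE X, ← Matrix.mulVec_mulVec, hXv, Matrix.mulVec_zero]

end Summit.MatrixMultiplication.MatrixMultiplication.Theorems
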